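import Summits.QuantumFields.YangMills.Theorems.BalabanUVNodesN12ChartCurvatureL1OfClass
import Literature.MathematicalPhysics.QuantumFieldTheory.Balaban1983to89.Node00.MultiScaleFibreChartB
import Literature.MathematicalPhysics.QuantumFieldTheory.Balaban1983to89.Node00.MultiScaleFibreChartCurvatureUniformB
import Literature.MathematicalPhysics.QuantumFieldTheory.Balaban1983to89.Node00.MultiScaleFibreChartLagrangeB
import Literature.MathematicalPhysics.QuantumFieldTheory.Balaban1983to89.Node00.MultiScaleFibreChartLocalityComponentB
import Summits.QuantumFields.YangMills.Theorems.BalabanUVNodesN12ChartRegularityTowerProxiesB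
import Summits.QuantumFields.YangMills.Theorems.BalabanUVNodesN12TowerProxiesOfClassB
import Summits.QuantumFields.YangMills.Theorems.BalabanUVNodesN12ChartCurvatureOfClassB
import HarnessLib

/-!
# DAG node N12 [B15] — THE ℓ¹-CURVATURE LETTER OF THE DIRECT ROAD WITH A PER-HEIGHT CONSTANT: component locality of the multi-scale chart in the chart variable, the — **BOND-DATUM EDITION** (`…N12ChartCurvatureL1OfClassB`, USED DECLARATIONS ONLY)

The print-datum ([Balaban1984PropagatorsII] (2.3)) (γ) twin of `Summits/…/Theorems/BalabanUVNodesN12ChartCurvatureL1OfClass.lean`: the declarations of the parent whose STATEMENT reads the determining datum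
(`hovl_geometric`, `norm_fderiv_fderiv_msChart_apply_le_local`, `sum_norm_fderiv_fderiv_msChart_apply_le_of_class`) and which N12's junction of record v14ᴸ uses (dag-n12-c g35 probe-2 census `UsedConstsN12RoadTyped2`, THEOREMS block), re-typed over a
BOND-LEVEL datum `𝔅 : BDetSet` (F0a `B15DeterminingSetsB`) and dag-n12-c's bond-datum chart `Node00.msChartB` (✓p774329; `msChart 𝐁 = msChartB (bondsDet 𝐁)` by `rfl`).  GENERATOR twin
(this seat's `work/g32/gen_thm.py`, block-extracted from the parent's tree bytes): namespace `…N12ChartCurvatureL1OfClassB`, SAME short names, `DetSet ↦ BDetSet`, `AgreeOn 𝐁 ↦ AgreeOnB 𝔅`,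
`IsMinimizer ↦ IsMinimizerB`, `bondsOf (𝐁 j) ↦ 𝔅 j`, `msChart ∕ constrCard ∕ constrEnum ∕ ConstrSet ↦ …B`, NODE 00 chart lemmas `…msChart… ↦ …msChartB…`; proofs VERBATIM; the parent's
datum-free declarations REUSED BY NAME (`open`), never copied (private plumbing excepted, №366 R2).  The parent's (b) statements are the instances `𝔅 := bondsDet 𝐁`.

Cell `pub-ymgap` (HUMAN RULINGS D-0062 ∕ D-0149), seat `pub-ymgap-dag-n12-d` g32 (R134 N12 [B15] s2; the (ii) Theorems-side re-key of N12's road at print's [II] (2.3) datum — director-ym №338 ∕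
№343 (E1)(iii-b), FLAG №16 ∕ ruling (α); dag-n12-c DESIGN memo a793b2ebc0b803bf (ii); `N12-ROAD-TWIN-ORDER-2026-08-30.md`).  Count-neutral helper of K1⁹ `stmt-QuantumFields-27364`,
`--kind proof --supports … --as helper`.  THEOREMS ONLY (0 `def`, 0 `instance`, 0 `sorry`).

HONEST FRAMING (director-ym №338 (5)).  PURELY ADDITIVE: the parent stays landed and true on its own text; nothing in it is edited; no displayed premise of any consumer is deleted or
weakened; every hypothesis of the parent stays a hypothesis.  Nothing of Bałaban's analysis asserted; N12 NOT discharged; K0⁷ ∕ K1⁹ NOT closed; counts unmoved (typed 28∕28 · discharged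
8∕27, A 8∕28; K 1∕4); one finite 𝕋⁴ programme at fixed ε — R4 closes the conditional rung `BalabanLadder.UV` only; NOT the Yang–Mills mass gap (Clay); nothing continuum ∕ ℝ⁴ ∕ OS.

PARENT's DOCSTRING (the mathematics and the citations; read the site-level `𝐁` as the bond datum `𝔅`):
# DAG node N12 [B15] — THE ℓ¹-CURVATURE LETTER OF THE DIRECT ROAD WITH A PER-HEIGHT CONSTANT: component locality of the multi-scale chart in the chart variable, the
# component-local curvature bound at a near-flat core, and its transport to a (2.12) minimiser through the class (uniformity pen ρ7, census §7 U2b; inhabits ρ6's `hM₂1`)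

[Balaban1985Variational] = «[15]», Sect. C (44)–(48) p. 285, (81)–(83) p. 290; [Balaban1988Convergent] = «[III]», (2.2) p. 255, (2.10)–(2.13) pp. 256–257;
[Balaban1989LargeFieldII] = «[LF-II]», (1.12)–(1.13) p. 359.

Cell `pub-ymgap`, HUMAN RULINGS D-0062 ∕ D-0149, lane owner `pub-ymgap-dag-n12-c` (g22).  Key K1⁹ `stmt-QuantumFields-27364`, `--kind proof --supports … --as helper`; count-neutral.
NEW leaf; CONSUMED BY NAME, nothing modified: this lane's `N12ChartCurvatureOfClass` (ρ5d p679666: `towerGauges_Bj_of_mem_class`, `msChart_gaugeAct_apply`, `fderiv_fderiv_conj_apply`,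
`gaugeAct_gaugeAct_inv`), `N12ChartRegularityTowerProxies.msChart_component_eq_of_towerProxy` (ρ5a), `N12TowerProxiesOfClass.chartLetters_msChart_Bj_of_isMinimizer_of_class` (ρ5b),
`Node00.fderiv_fderiv_apply_pi` ∕ `regularity_binders_msChart` ∕ `contDiffAt_msChart` ∕ `msChart_apply_congr_of_eqOn_feeds_right` (dag-n12-w4 ∕ n07-e; `Node00/MultiScaleFibreChartLocalityComponent`),
`B14.Eq216Concrete.feeds` (r12).

WHY (census `N12-DIRECT-ROW-CENSUS-2026-08-28.md` §7 U2b; memo `N12-UNIFORMITY-SPEC.md`).  ρ6 (`N12DirectChartPackageOfClassL1`) displays the chart curvature of the (μ) row through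
the ℓ¹-CURVATURE LETTER `hM₂1 : Σ_c ‖D²Ψ_{U₀}(0)(w,w)_c‖ ≤ M₂′·Σ_b ‖w_b‖²`; its inhabitant of record from the sup-curvature letter carries the constraint count `#constraints·M₂`.
THIS FILE gives the inhabitant with a PER-HEIGHT factor instead: the `(j,c)`-component of the chart `Ψ(X) = (π log(W_j(c)*·Ū^j(U·e^X)(c)))_{(j,c)}` depends on `X` only on the fine
bonds `feeds j c` (dag-n12-w4's `msChart_apply_congr_of_eqOn_feeds_right`, from r12's `iter_local`), so `D²Ψ(0)(w,w)_{(j,c)} = D²Ψ(0)(1_{feeds}w, 1_{feeds}w)_{(j,c)}` and the sup-curvature bound `M₂‖1_{feeds}w‖²_∞ ≤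
M₂·Σ_{b ∈ feeds j c} ‖w_b‖²` localises each component; summing, every fine bond is counted once per constrained bond it feeds — at most `ovl := max_b #{(j,c) : b ∈ feeds j c}`
times, a LOCAL count, bounded in closed form by `Σ_{j ≤ k} (2d)^j` (§5: at most `2d` bonds share an endpoint, induction over `feeds`) — a PER-HEIGHT number.  The transport from a near-flat core to the (2.12) minimiser is
ρ5d's per-component gauge covariance (one tower gauge per constrained bond; `Ad` is a bondwise isometry, so `Σ_{b ∈ feeds} ‖(𝒜w)_b‖² = Σ_{b ∈ feeds} ‖w_b‖²`).

CONTENTS (namespace `Summit.QuantumFields.YangMills.BalabanUVNodes.N12ChartCurvatureL1OfClass`; theorems only — no `def`, no `instance`, no `sorry`).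
* §1 `norm_indicator_sq_le_sum_sq` (`‖1_S w‖²_∞ ≤ Σ_{b ∈ S} ‖w_b‖²`); component locality in `X` is dag-n12-w4's `Node00.msChart_apply_congr_of_eqOn_feeds_right` (cited, not restated).
* §2 `fderiv_fderiv_apply_eq_of_comp_right` — `D²g(0)(w,w) = D²g(0)(πw,πw)` for `g = g ∘ π`, `π` continuous linear, `g` `C²` at `0` [folklore].
* §3 ★★ `norm_fderiv_fderiv_msChart_apply_le_local` — at a GUARDED base field in the fibre with the sup-curvature bound `‖D²Ψ(0)(w,w)‖ ≤ M₂‖w‖²` for all `w`: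
  `‖D²Ψ(0)(w,w)_{(j,c)}‖ ≤ M₂·Σ_{b ∈ feeds j c} ‖w_b‖²`.
* §4 ★★★ `sum_norm_fderiv_fderiv_msChart_apply_le_of_class` — ρ6's letter `hM₂1` at a (2.12) minimiser from the class (ρ5d's displayed rows VERBATIM: `k+1 ≤ m+K`, `4L ≤ M₁`, cube
  divisibility, `0 ≤ εreg`, `hsbU`, `hcurv`, the floor `6(d−1)L·εreg ≤ ρ″`) plus the local-count letter `hovl`: `Σ_i ‖D²Ψ_{U₀}(0)(w,w)_i‖ ≤ (ovl·M₂)·Σ_b ‖w_b‖²`; `hovl_trivial`.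
* §5 `card_filter_src_eq_or_tgt_eq_le` (≤ `2d` bonds at a site), ★ `card_filter_mem_feeds_le` (a fine bond feeds ≤ `(2d)^j` level-`j` bonds), ★★ `hovl_geometric` — the letter `hovl`
  inhabited at `ovl := Σ_{j ≤ k} (2d)^j` for EVERY determining set: per height, torus-free.

HONEST FRAMING ∕ LOCATED.  Kernel calculus + lattice bookkeeping over landed modules; `M₂`, `ρ″` stay ∃-constants per height `(F, K, k)` (compactness over the torus's field space —
census U4, NOT print's numbers); `ovl = Σ_{j ≤ k} (2d)^j` is per height but not print's `O(1)` bookkeeping of (1.12); nothing of Bałaban's asserted; count-neutral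
helper; N12 NOT discharged; K1⁹ NOT closed; counts unmoved; one finite 𝕋⁴ programme at fixed ε — R4 closes the conditional finite-𝕋⁴ rung `BalabanLadder.UV` only; NOT continuum ∕ OS ∕
mass gap ∕ Clay.
-/

noncomputable section

open scoped BigOperators Matrix.Norms.L2Operator Topology
open Filter Finset

namespace Summit.QuantumFields.YangMills.BalabanUVNodes.N12ChartCurvatureL1OfClassB

open Literature.MathematicalPhysics.QuantumFieldTheory.Balaban1983to89.B15DeterminingSetsB

open Literature.MathematicalPhysics.QuantumFieldTheory.Balaban1983to89
open T4Continuum (T4Family)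
open T4AdjointCovarianceUnitary (lieSU specialUnitaryAd coe_specialUnitaryAd norm_specialUnitaryAd)
open B15DeterminingSets
open B14.Eq213MaximalDomains (side)
open B14.Eq213DetSet (Bj Bj_of_gt maxDomT)
open B14.Eq216Concrete (feeds feeds_zero mem_feeds_succ)
open B16Sect1Backgrounds (toMS iter_gaugeAct)
open Node00
open MatrixLog (mlog)
open Summit.QuantumFields.YangMills.BalabanUVNodes.N12ChartRegularityTowerProxiesB (msChart_component_eq_of_towerProxy)
open Summit.QuantumFields.YangMills.BalabanUVNodes.N12TowerProxiesOfClassB (chartLetters_msChart_lamBondsSeq_of_isMinimizer_of_class)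
open Summit.QuantumFields.YangMills.BalabanUVNodes.N12ChartCurvatureOfClass (fderiv_fderiv_conj_apply gaugeAct_gaugeAct_inv)
open Summit.QuantumFields.YangMills.BalabanUVNodes.N12ChartCurvatureOfClassB (towerGauges_lamBondsSeq_of_mem_class msChart_gaugeAct_apply)
open Summit.QuantumFields.YangMills.BalabanUVNodes.N12ChartCurvatureL1OfClass (card_filter_mem_feeds_le fderiv_fderiv_apply_eq_of_comp_right norm_indicator_sq_le_sum_sq)

section
variable {F : T4Family} {N : ℕ} [NeZero N] {K k : ℕ}
variable {𝔅 : BDetSet (F.P K)} {W : MSField (F.P K) (SU N)} {V : GaugeField (F.P K) 0 (SU N)}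

/-- ★★ **THE COMPONENT-LOCAL CURVATURE BOUND AT A GUARDED BASE FIELD**: if `V` is guarded below `k` and in the fibre of `W` on `𝐁` (so the chart is `C^∞` at `0`), and the
sup-curvature bound `‖D²Ψ_V(0)(w,w)‖ ≤ M₂‖w‖²` holds for every `w` (`Node00.exists_uniform_chartCurvatureB_sq_bound` at a `ρ″`-near-flat `V`), then each component is controlled by
the chart variable ON ITS OWN FEEDING BONDS: `‖D²Ψ_V(0)(w,w)_{(j,c)}‖ ≤ M₂·Σ_{b ∈ feeds j c} ‖w_b‖²` (§1 locality + §2 at the truncation `1_{feeds j c}`).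
[cite: Balaban1985Variational, Sect. C (47) p.285, (81)–(83) p.290; Balaban1988Convergent, (2.10)–(2.11) p.256; Balaban1989LargeFieldII, (1.12) p.359] -/
theorem norm_fderiv_fderiv_msChart_apply_le_local (hk : k ≤ (F.P K).m + (F.P K).K) (hfib : AgreeOnB 𝔅 (avgFamily (avOfRecord F N K) V) W)
    (hsb : SmallBelow (avOfRecord F N K) k V) {M₂ : ℝ} (hM₂ : 0 ≤ M₂)
    (hcurv : ∀ w : PBond (F.P K) 0 → lieSU (Fin N), ‖fderiv ℝ (fderiv ℝ (msChartB F N K k 𝔅 W V)) 0 w w‖ ≤ M₂ * ‖w‖ ^ 2)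
    (i : Fin (constrCardB 𝔅 k)) (S : Finset (PBond (F.P K) 0))
    (hS : ∀ b, b ∈ feeds (((constrEnumB 𝔅 k).symm i).1 : ℕ) ((constrEnumB 𝔅 k).symm i).2.1 → b ∈ S) (w : PBond (F.P K) 0 → lieSU (Fin N)) :
    ‖fderiv ℝ (fderiv ℝ (msChartB F N K k 𝔅 W V)) 0 w w i‖ ≤ M₂ * ∑ b ∈ S, ‖w b‖ ^ 2 := by
  classical
  -- the truncation to `S` as a continuous linear map
  let π : (PBond (F.P K) 0 → lieSU (Fin N)) →L[ℝ] (PBond (F.P K) 0 → lieSU (Fin N)) :=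
    ContinuousLinearMap.pi fun b => if b ∈ S then ContinuousLinearMap.proj b else 0
  have hπ : ∀ X b, π X b = if b ∈ S then X b else 0 := by
    intro X b
    simp only [π, ContinuousLinearMap.pi_apply]
    split_ifs <;> simp
  -- regularity at the guarded base field
  obtain ⟨hΨ₂, hΨd⟩ := regularity_binders_msChartB (k := k) (𝔅 := 𝔅) hfib hsb
  have hC : ContDiffAt ℝ 2 (fun X => msChartB F N K k 𝔅 W V X i) 0 := (contDiffAt_pi.1 (contDiffAt_msChartB (k := k) (𝔅 := 𝔅) hfib hsb) i).of_le le_top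
  -- locality of the component: `Ψ(πX)_i = Ψ(X)_i`
  have hgl : ∀ X, msChartB F N K k 𝔅 W V (π X) i = msChartB F N K k 𝔅 W V X i := fun X =>
    msChartB_apply_congr_of_eqOn_feeds_right hk i fun b hb => by rw [hπ, if_pos (hS b hb)]
  have e1 := fderiv_fderiv_apply_pi hΨd hΨ₂.differentiableAt i w w
  have e2 := fderiv_fderiv_apply_eq_of_comp_right π hC hgl w
  have e3 := fderiv_fderiv_apply_pi hΨd hΨ₂.differentiableAt i (π w) (π w)
  have c1 : ‖fderiv ℝ (fderiv ℝ (msChartB F N K k 𝔅 W V)) 0 w w i‖ = ‖fderiv ℝ (fderiv ℝ (fun X => msChartB F N K k 𝔅 W V X i)) 0 (π w) (π w)‖ :=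
    congrArg norm (e1.trans e2)
  have c2 : ‖fderiv ℝ (fderiv ℝ (fun X => msChartB F N K k 𝔅 W V X i)) 0 (π w) (π w)‖ = ‖fderiv ℝ (fderiv ℝ (msChartB F N K k 𝔅 W V)) 0 (π w) (π w) i‖ :=
    congrArg norm e3.symm
  calc ‖fderiv ℝ (fderiv ℝ (msChartB F N K k 𝔅 W V)) 0 w w i‖
      = ‖fderiv ℝ (fderiv ℝ (msChartB F N K k 𝔅 W V)) 0 (π w) (π w) i‖ := c1.trans c2
    _ ≤ ‖fderiv ℝ (fderiv ℝ (msChartB F N K k 𝔅 W V)) 0 (π w) (π w)‖ := norm_le_pi_norm _ i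
    _ ≤ M₂ * ‖π w‖ ^ 2 := hcurv (π w)
    _ ≤ M₂ * ∑ b ∈ S, ‖w b‖ ^ 2 := by
        refine mul_le_mul_of_nonneg_left ?_ hM₂
        have hfun : (π w : PBond (F.P K) 0 → lieSU (Fin N)) = fun b => if b ∈ S then w b else 0 := funext (hπ w)
        rw [hfun]
        exact norm_indicator_sq_le_sum_sq S w

end

section
variable {F : T4Family} {N : ℕ} [NeZero N] {K k : ℕ}

/-- ★★★ **THE ℓ¹-CURVATURE LETTER `hM₂1` OF ρ6 AT A (2.12) MINIMISER, WITH A LOCAL-COUNT FACTOR** — `N12ChartCurvatureOfClass.norm_fderiv_fderiv_msChart_le_of_class` (ρ5d)'s displayed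
rows VERBATIM (`k+1 ≤ m+K`, `4L ≤ M₁`, the cube divisibility, `0 ≤ εreg`, the per-height letters `hsbU` ∕ `hcurv` of `Node00.exists_uniform_chartCurvatureB_sq_bound k`, the floor
`6(d−1)L·εreg ≤ ρ″`) plus ONE combinatorial letter `hovl : every fine bond feeds at most ovl constrained bonds of 𝐁_k(Z)` (a LOCAL count; trivially inhabited by `ovl := #constraints`,
per height by the block geometry), conclude `Σ_i ‖D²Ψ_{𝐁_k(Z),W,U₀}(0)(w,w)_i‖ ≤ (ovl·M₂)·Σ_b ‖w_b‖²`.  Per component: ρ5d's tower gauge and gauge covariance, then §3 at the near-flat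
core in the transformed coordinate `𝒜w` (a bondwise isometry: `Σ_{b ∈ feeds} ‖(𝒜w)_b‖² = Σ_{b ∈ feeds} ‖w_b‖²`); then the double count.
[cite: Balaban1985Variational, Sect. C (44)–(48) p.285, (81)–(83) p.290, (153) p.301; Balaban1989LargeFieldII, (1.12)–(1.13) p.359; Balaban1988Convergent, (2.10)–(2.13) pp.256–257] -/
theorem sum_norm_fderiv_fderiv_msChart_apply_le_of_class (ν : Stage7Numerics) (Kt : ℕ) {k : ℕ} (Z : Set (Site (F.P Kt) 0))
    (hkK : k + 1 ≤ (F.P Kt).m + (F.P Kt).K) (hM4 : 4 * (F.P Kt).L ≤ ν.M₁) (hdiv : side (F.P Kt).L ν.M₁ k ∣ (F.P Kt).sitesPerDir 0)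
    (hε : 0 ≤ ν.εreg) {ρ'' M₂ : ℝ} (hM₂0 : 0 ≤ M₂)
    (hsbU : ∀ V : GaugeField (F.P Kt) 0 (SU N), ‖coeField V - 1‖ ≤ ρ'' → SmallBelow (avOfRecord F N Kt) k V)
    (hcurv : ∀ (𝔅 : BDetSet (F.P Kt)) (W : MSField (F.P Kt) (SU N)) (V : GaugeField (F.P Kt) 0 (SU N)),
      ‖coeField V - 1‖ ≤ ρ'' → AgreeOnB 𝔅 (avgFamily (avOfRecord F N Kt) V) W →
      ∀ w : PBond (F.P Kt) 0 → lieSU (Fin N), ‖fderiv ℝ (fderiv ℝ (msChartB F N Kt k 𝔅 W V)) 0 w w‖ ≤ M₂ * ‖w‖ ^ 2)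
    (hερ : 6 * ((((F.P Kt).d - 1 : ℕ)) : ℝ) * (F.P Kt).L * ν.εreg ≤ ρ'')
    -- the LOCAL COUNT letter: every fine bond feeds at most `ovl` constrained bonds of `𝐁_k(Z)`
    {ovl : ℕ} (hovl : ∀ (b : PBond (F.P Kt) 0) (s : Finset (Fin (constrCardB (lamBondsSeq (maxDomT ν.M₁ Z) k) k))),
      (∀ i ∈ s, b ∈ feeds (((constrEnumB (lamBondsSeq (maxDomT ν.M₁ Z) k) k).symm i).1 : ℕ) ((constrEnumB (lamBondsSeq (maxDomT ν.M₁ Z) k) k).symm i).2.1) → s.card ≤ ovl)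
    {W : MSField (F.P Kt) (SU N)} {U₀ : GaugeField (F.P Kt) 0 (SU N)}
    (h : IsMinimizerB (avOfRecord F N Kt) (regMSCoPOfRecord F N ν Kt k (maxDomT ν.M₁ Z)) (lamBondsSeq (maxDomT ν.M₁ Z) k) W U₀)
    (w : PBond (F.P Kt) 0 → lieSU (Fin N)) :
    ∑ i, ‖fderiv ℝ (fderiv ℝ (msChartB F N Kt k (lamBondsSeq (maxDomT ν.M₁ Z) k) W U₀)) 0 w w i‖ ≤ ((ovl : ℝ) * M₂) * ∑ b, ‖w b‖ ^ 2 := by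
  classical
  have hk : k ≤ (F.P Kt).m + (F.P Kt).K := by omega
  have h𝔅 : ∀ j, k < j → (lamBondsSeq (maxDomT ν.M₁ Z) k : BDetSet (F.P Kt)) j = ∅ := fun _ hj => lamBondsSeq_of_gt _ _ hj
  -- regularity of the chart at `U₀` (from the class, ρ5b)
  obtain ⟨-, -, ⟨hΨ₂, hΨd⟩, -⟩ := chartLetters_msChart_lamBondsSeq_of_isMinimizer_of_class ν Kt Z hkK hM4 hdiv hε hsbU hερ h
  -- the feeding sets as finite sets
  let S : Fin (constrCardB (lamBondsSeq (maxDomT ν.M₁ Z) k) k) → Finset (PBond (F.P Kt) 0) := fun i =>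
    Finset.univ.filter fun b => b ∈ feeds (((constrEnumB (lamBondsSeq (maxDomT ν.M₁ Z) k) k).symm i).1 : ℕ) ((constrEnumB (lamBondsSeq (maxDomT ν.M₁ Z) k) k).symm i).2.1
  have hS : ∀ i b, b ∈ feeds (((constrEnumB (lamBondsSeq (maxDomT ν.M₁ Z) k) k).symm i).1 : ℕ) ((constrEnumB (lamBondsSeq (maxDomT ν.M₁ Z) k) k).symm i).2.1 → b ∈ S i :=
    fun i b hb => Finset.mem_filter.2 ⟨Finset.mem_univ _, hb⟩
  -- ### per component: the local bound transported through the tower gauge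
  have hcomp_i : ∀ i, ‖fderiv ℝ (fderiv ℝ (msChartB F N Kt k (lamBondsSeq (maxDomT ν.M₁ Z) k) W U₀)) 0 w w i‖ ≤ M₂ * ∑ b ∈ S i, ‖w b‖ ^ 2 := by
    intro i
    -- the gauge and the near-flat core of the `i`-th tower
    obtain ⟨u, V, hV, hin⟩ := towerGauges_lamBondsSeq_of_mem_class ν Kt Z hkK hM4 hdiv hε h.1 i
    set U' : GaugeField (F.P Kt) 0 (SU N) := GaugeField.gaugeAct (fun s => (u s)⁻¹ : GaugeTransf (F.P Kt) 0 (SU N)) V with hU'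
    have hVρ : ‖coeField V - 1‖ ≤ ρ'' := hV.trans hερ
    have hsbV : SmallBelow (avOfRecord F N Kt) k V := hsbU V hVρ
    have huU' : GaugeField.gaugeAct u U' = V := gaugeAct_gaugeAct_inv u V
    -- the proxy chart and its `i`-th component
    set W' : MSField (F.P Kt) (SU N) := avgFamily (avOfRecord F N Kt) U' with hW'
    have hcomp := msChart_component_eq_of_towerProxy (𝔅 := lamBondsSeq (maxDomT ν.M₁ Z) k) (W := W) (U := U₀) hk h.2.1 i hin
    -- the transformed pair (`V = u•U'`, `W'^u`) and the coordinate isometry `𝒜`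
    set Wu : MSField (F.P Kt) (SU N) := fun j c => toMS u j c.src * W' j c * (toMS u j c.tgt)⁻¹ with hWu
    let 𝒜 : (PBond (F.P Kt) 0 → lieSU (Fin N)) ≃L[ℝ] (PBond (F.P Kt) 0 → lieSU (Fin N)) :=
      ContinuousLinearEquiv.piCongrRight fun b => (specialUnitaryAd (u b.tgt)).toContinuousLinearEquiv
    have h𝒜 : ∀ X b, 𝒜 X b = specialUnitaryAd (u b.tgt) (X b) := fun X b => rfl
    set bi : SU N := toMS u (((constrEnumB (lamBondsSeq (maxDomT ν.M₁ Z) k) k).symm i).1 : ℕ) ((constrEnumB (lamBondsSeq (maxDomT ν.M₁ Z) k) k).symm i).2.1.tgt with hbi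
    let L : lieSU (Fin N) ≃L[ℝ] lieSU (Fin N) := (specialUnitaryAd bi).toContinuousLinearEquiv
    have hcov : ∀ X, msChartB F N Kt k (lamBondsSeq (maxDomT ν.M₁ Z) k) Wu V (𝒜 X) i = L (msChartB F N Kt k (lamBondsSeq (maxDomT ν.M₁ Z) k) W' U' X i) := by
      intro X
      have hX : (𝒜 X : PBond (F.P Kt) 0 → lieSU (Fin N)) = fun b => specialUnitaryAd (u b.tgt) (X b) := funext (h𝒜 X)
      show msChartB F N Kt k (lamBondsSeq (maxDomT ν.M₁ Z) k) Wu V (𝒜 X) i = specialUnitaryAd bi (msChartB F N Kt k (lamBondsSeq (maxDomT ν.M₁ Z) k) W' U' X i)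
      rw [hX, ← huU']
      exact msChart_gaugeAct_apply hk u W' U' X i
    have hconj := fderiv_fderiv_conj_apply 𝒜 L (f := fun Y => msChartB F N Kt k (lamBondsSeq (maxDomT ν.M₁ Z) k) W' U' Y i)
      (g := fun Y => msChartB F N Kt k (lamBondsSeq (maxDomT ν.M₁ Z) k) Wu V Y i) hcov w
    -- the chart at `V` is regular (near-flat core) and in the fibre of `W'^u`
    have hfibV : AgreeOnB (lamBondsSeq (maxDomT ν.M₁ Z) k) (avgFamily (avOfRecord F N Kt) V) Wu := by
      intro j c hc
      by_cases hj : j ≤ k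
      · show Averaging.iter (avOfRecord F N Kt) j V c = _
        rw [← huU', iter_gaugeAct (avOfRecord F N Kt) u U' j (hj.trans hk)]
        rfl
      · exfalso; rw [h𝔅 j (lt_of_not_ge hj)] at hc; simp at hc
    obtain ⟨hΨ₂V, hΨdV⟩ := regularity_binders_msChartB (k := k) (𝔅 := lamBondsSeq (maxDomT ν.M₁ Z) k) hfibV hsbV
    -- the component-local bound at the near-flat core, in the transformed coordinate
    have hloc : ‖fderiv ℝ (fderiv ℝ (msChartB F N Kt k (lamBondsSeq (maxDomT ν.M₁ Z) k) Wu V)) 0 (𝒜 w) (𝒜 w) i‖ ≤ M₂ * ∑ b ∈ S i, ‖(𝒜 w) b‖ ^ 2 :=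
      norm_fderiv_fderiv_msChart_apply_le_local hk hfibV hsbV hM₂0 (hcurv (lamBondsSeq (maxDomT ν.M₁ Z) k) Wu V hVρ hfibV) i (S i) (hS i) (𝒜 w)
    have hiso : ∑ b ∈ S i, ‖(𝒜 w) b‖ ^ 2 = ∑ b ∈ S i, ‖w b‖ ^ 2 :=
      Finset.sum_congr rfl fun b _ => by rw [h𝒜, norm_specialUnitaryAd]
    -- assemble: component at `U₀` = component of the proxy chart = conjugate of the `V`-chart's component at `𝒜 w`
    have e1 := fderiv_fderiv_apply_pi hΨd hΨ₂.differentiableAt i w w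
    have e2 : fderiv ℝ (fderiv ℝ (fun X => msChartB F N Kt k (lamBondsSeq (maxDomT ν.M₁ Z) k) W U₀ X i)) 0 w w
        = fderiv ℝ (fderiv ℝ (fun X => msChartB F N Kt k (lamBondsSeq (maxDomT ν.M₁ Z) k) W' U' X i)) 0 w w := by rw [hcomp]
    have e3 := fderiv_fderiv_apply_pi hΨdV hΨ₂V.differentiableAt i (𝒜 w) (𝒜 w)
    have c1 : ‖fderiv ℝ (fderiv ℝ (msChartB F N Kt k (lamBondsSeq (maxDomT ν.M₁ Z) k) W U₀)) 0 w w i‖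
        = ‖fderiv ℝ (fderiv ℝ (fun X => msChartB F N Kt k (lamBondsSeq (maxDomT ν.M₁ Z) k) W' U' X i)) 0 w w‖ := congrArg norm (e1.trans e2)
    have c2 : ‖fderiv ℝ (fderiv ℝ (fun X => msChartB F N Kt k (lamBondsSeq (maxDomT ν.M₁ Z) k) W' U' X i)) 0 w w‖
        = ‖L (fderiv ℝ (fderiv ℝ (fun X => msChartB F N Kt k (lamBondsSeq (maxDomT ν.M₁ Z) k) W' U' X i)) 0 w w)‖ := (norm_specialUnitaryAd bi _).symm
    have c3 : ‖L (fderiv ℝ (fderiv ℝ (fun X => msChartB F N Kt k (lamBondsSeq (maxDomT ν.M₁ Z) k) W' U' X i)) 0 w w)‖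
        = ‖fderiv ℝ (fderiv ℝ (fun Y => msChartB F N Kt k (lamBondsSeq (maxDomT ν.M₁ Z) k) Wu V Y i)) 0 (𝒜 w) (𝒜 w)‖ := congrArg norm hconj.symm
    have c4 : ‖fderiv ℝ (fderiv ℝ (fun Y => msChartB F N Kt k (lamBondsSeq (maxDomT ν.M₁ Z) k) Wu V Y i)) 0 (𝒜 w) (𝒜 w)‖
        = ‖fderiv ℝ (fderiv ℝ (msChartB F N Kt k (lamBondsSeq (maxDomT ν.M₁ Z) k) Wu V)) 0 (𝒜 w) (𝒜 w) i‖ := congrArg norm e3.symm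
    rw [← hiso]
    exact (c1.trans (c2.trans (c3.trans c4))).trans_le hloc
  -- ### the double count: every fine bond is counted once per constrained bond it feeds, at most `ovl` times
  have hcount : ∀ b : PBond (F.P Kt) 0, ((Finset.univ.filter fun i : Fin (constrCardB (lamBondsSeq (maxDomT ν.M₁ Z) k) k) => b ∈ S i).card : ℝ) ≤ ovl := by
    intro b
    exact_mod_cast hovl b _ fun i hi => (Finset.mem_filter.1 (Finset.mem_filter.1 hi).2).2
  calc ∑ i, ‖fderiv ℝ (fderiv ℝ (msChartB F N Kt k (lamBondsSeq (maxDomT ν.M₁ Z) k) W U₀)) 0 w w i‖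
      ≤ ∑ i, M₂ * ∑ b ∈ S i, ‖w b‖ ^ 2 := Finset.sum_le_sum fun i _ => hcomp_i i
    _ = M₂ * ∑ i, ∑ b ∈ S i, ‖w b‖ ^ 2 := by rw [Finset.mul_sum]
    _ = M₂ * ∑ i, ∑ b, (if b ∈ S i then ‖w b‖ ^ 2 else 0) := by
        congr 1; refine Finset.sum_congr rfl fun i _ => ?_; rw [Finset.sum_ite_mem, Finset.univ_inter]
    _ = M₂ * ∑ b, ∑ i, (if b ∈ S i then ‖w b‖ ^ 2 else 0) := by rw [Finset.sum_comm]
    _ = M₂ * ∑ b, ((Finset.univ.filter fun i : Fin (constrCardB (lamBondsSeq (maxDomT ν.M₁ Z) k) k) => b ∈ S i).card : ℝ) * ‖w b‖ ^ 2 := by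
        congr 1; refine Finset.sum_congr rfl fun b _ => ?_
        rw [← Finset.sum_filter, Finset.sum_const, nsmul_eq_mul]
    _ ≤ M₂ * ∑ b, (ovl : ℝ) * ‖w b‖ ^ 2 := by
        refine mul_le_mul_of_nonneg_left (Finset.sum_le_sum fun b _ => ?_) hM₂0
        exact mul_le_mul_of_nonneg_right (hcount b) (sq_nonneg _)
    _ = ((ovl : ℝ) * M₂) * ∑ b, ‖w b‖ ^ 2 := by rw [← Finset.mul_sum]; ring

end

section
variable {F : T4Family} {N : ℕ} [NeZero N] {K k : ℕ}
variable {P : Params}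
open scoped Classical in

/-- ★★ **THE LOCAL-COUNT LETTER `hovl` IN CLOSED FORM**: every fine bond feeds at most `Σ_{j ≤ k} (2d)^j` constrained bonds of levels `≤ k` of ANY determining set — a per-height
number, independent of the torus and of the determining set. [cite: Balaban1988Convergent, (2.2) p.255, (2.11) p.256 (bookkeeping)] -/
theorem hovl_geometric (𝔅 : BDetSet P) (k : ℕ) (b : PBond P 0) (s : Finset (Fin (constrCardB 𝔅 k)))
    (h : ∀ i ∈ s, b ∈ feeds (((constrEnumB 𝔅 k).symm i).1 : ℕ) ((constrEnumB 𝔅 k).symm i).2.1) :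
    s.card ≤ ∑ j ∈ Finset.range (k + 1), (2 * P.d) ^ j := by
  classical
  let φ : Fin (constrCardB 𝔅 k) → (Σ j : Fin (k + 1), PBond P j) :=
    Sigma.map id (fun _ => Subtype.val) ∘ (constrEnumB 𝔅 k).symm
  have hφ : Function.Injective φ :=
    (Function.Injective.sigma_map Function.injective_id fun _ => Subtype.val_injective).comp (constrEnumB 𝔅 k).symm.injective
  let T : Finset (Σ j : Fin (k + 1), PBond P j) :=
    Finset.univ.sigma fun j : Fin (k + 1) => Finset.univ.filter fun c : PBond P j => b ∈ feeds (j : ℕ) c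
  have hmaps : ∀ i ∈ s, φ i ∈ T := fun i hi =>
    Finset.mem_sigma.2 ⟨Finset.mem_univ _, Finset.mem_filter.2 ⟨Finset.mem_univ _, h i hi⟩⟩
  calc s.card ≤ T.card := Finset.card_le_card_of_injOn φ hmaps (hφ.injOn)
    _ = ∑ j : Fin (k + 1), (Finset.univ.filter fun c : PBond P j => b ∈ feeds (j : ℕ) c).card := Finset.card_sigma _ _
    _ ≤ ∑ j : Fin (k + 1), (2 * P.d) ^ (j : ℕ) := Finset.sum_le_sum fun j _ => card_filter_mem_feeds_le b j
    _ = ∑ j ∈ Finset.range (k + 1), (2 * P.d) ^ j := Fin.sum_univ_eq_sum_range (fun j => (2 * P.d) ^ j) (k + 1)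

end

end Summit.QuantumFields.YangMills.BalabanUVNodes.N12ChartCurvatureL1OfClassB

end
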